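import Summits.QuantumFields.YangMills.Theorems.UnitScaleTiltProp7MassivePropagatorAgmonLetters
import Summits.QuantumFields.YangMills.Theorems.UnitScaleTiltProp7LandauDictT3
import HarnessLib

/-!
# Route `UnitScaleTilt`, crux «MinimiserStabilityRegPr» (stmt-QuantumFields-19200, stub EX), EX row `hGF`[Lift] (curved member), the LOD line, ★p1 g24's `LOCATE-L6-ASSEMBLY`
# §1 Step I.2 pen (L5″) (routeR-w3 g12, «px5: (M) — GO») — **(M-I) LETTERS for the member form rows of the cut-off comparison (Laplacian part): for two backgrounds `U, V` that are
# `δη`-close on the support of a real cutoff `χ` with bond steps `≤ θ`, the twisted difference `χ·Δ_V − Δ_U·χ` tested between `z` and `w` is bounded by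
# `(c‖D_Vw‖ + c‖w‖)(‖D_Uz‖ + ‖z‖)` with `c = √3η⁻¹θ + √24·δ + 2√3η⁻¹θ·√24δ`** — the `hform` binder of ✓p750050 `Prop7CutoffResolventComparison.norm_inv_cutoff_comm_le_of_form`
# for the MASSLESS systems; K-free when `θ ≤ η∕(R″−R′)` (block-Lipschitz `χ`, chair pin (P2)) and `δ = 6R″ε₀` ([B6] Lemma 1) (ym3-torus-px5 g11, `LOCATE-L5pp-localisation-px5g11.md`).

Cell `ym3-torus` (HUMAN RULING D-0037: YM₃ on T³ is ladder rung R3 — NOT d = 4, NOT infinite volume, NOT a mass gap, NOT Clay).  Width seat `ym3-torus-px5` (gen 11; WIDTH COPY of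
ym3-torus-p1).  THEOREMS ONLY (0 `def`, 0 `sorry`); `--supports stmt-QuantumFields-19200 --as helper`, count-neutral.  HONEST LABEL (№33 (6)): curved γ-row supplier line (LOD
localisation); member letters for (L5″)∕(L5); nothing of (L5″), (L6), (3.49), `h349`, `hGF`, EX ∕ 19200 is proved.

THE POINT.  `X A_V − A_U X = (XΔ_V − Δ_V X) + (Δ_V − Δ_U)X` (+ mass terms, FILE (M-II)).  Both pieces are second order, small only as FORMS, and each pairing sees `U − V` only through
bonds meeting `supp χ` ∪ {bonds along which `χ` changes}: (i) the commutator `⟪z, (χΔ_V − Δ_Vχ)w⟫ = ⟪K_χz, D_Vw⟫ − ⟪D_Vz, K_χw⟫` with the Leibniz defect `K_χy(b) =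
η⁻¹(χ(b₊) − χ(b₋))·Ad(V_b)y(b₊)` (✓`Prop7Lane2CutoffCommutators.DL2_smul_sub_smul_eq_toL2`; the `χ(b₋)·` parts cancel by symmetry of real bond multipliers, FILE A
`inner_toL2_smul_left`), `‖K_χy‖ ≤ √3η⁻¹θ‖y‖`, and `D_Vz = D_Uz − (D_U − D_V)z` where ONLY the bonds carrying `K_χw` count: there `‖U_b − V_b‖ ≤ δη` makes `η⁻¹(Ad U_b − Ad V_b)`
BOUNDED by `2δ`; (ii) `⟪z, (Δ_V − Δ_U)(χw)⟫ = ⟪(D_V − D_U)z, D_V(χw)⟫ + ⟪D_Uz, (D_V − D_U)(χw)⟫` with the same locality.  No `η⁻¹` survives except the displayed `η⁻¹θ`.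

WHAT IS PROVED (sorry-free, no definition; ns `…Theorems.Prop7CutoffLaplacianLetters`; member `F n K c₀`, backgrounds `U V`, real `χ`).
* `DL2_sub_DL2_symm_apply` (`(D_U − D_V)l (b) = η⁻¹(Ad U_b − Ad V_b) l(b₊)`), `sum_normSq_DL2_sub_DL2_apply_le` (one bond: `hs ≤ 8δ²·hs(l(b₊))` under `‖U_b − V_b‖ ≤ δη`),
  `norm_inner_toL2_le_of_support` (a pairing with a bond field supported in `S` costs only the `S`-part), `normSq_on_DL2_sub_DL2_le` (`c₀Σ_{b∈S} hs((D_U − D_V)l)_b ≤ 24δ²‖toL2S l‖²`),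
  `norm_toL2_smul_le` (bounded bond multipliers), `norm_leibnizDefect_le` (`‖K_χ y‖ ≤ √3η⁻¹θ‖y‖`, ✓`norm_sq_DL2_smul_sub_le` at `S = univ`).
HONEST SCOPE.  Member bookkeeping over landed Leibniz rows; no mass term (FILE (M-II)), no inverse, no decay; nothing of (L5″)∕(L6), `hGF`, `h349`, EX or the crux is proved here.

References: T. Bałaban, CMP **99** (1985) 389–434 [Balaban1985BackgroundPropagators] ((3.3) p.391, (3.8) p.392, (3.100)–(3.105) pp.413–414, Thm 3.3 p.399); CMP **96** (1984) 223–250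
[Balaban1984PropagatorsII] (p.238); CMP **99** (1985) 75–102 [Balaban1985RegularSpaces] (Lemma 1 (1.25) p.79, the axial gauge on a cube).
-/

set_option autoImplicit false

noncomputable section

open scoped BigOperators Matrix.Norms.L2Operator InnerProductSpace ComplexConjugate

namespace Summit.QuantumFields.YangMills.Theorems.Prop7CutoffLaplacianLetters

open Literature.MathematicalPhysics.QuantumFieldTheory.Balaban1983to89
open Finset
open B7Prop1Explicit (U1)
open B7Eq78Linearization (conjR conjR_apply)
open B9Eq39Adjoint (R)
open B11Eq103H1Complex (SiteL2K BondL2K)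
open Literature.MathematicalPhysics.QuantumFieldTheory.Balaban1983to89.T3ContinuumYM3Torus
open T3SectALandauChart (eta eta_pos bgUnits covDerivFwdT)
open Summit.QuantumFields.YangMills.Theorems.Prop7SectET3Transport (periodsT3)
open Summit.QuantumFields.YangMills.Theorems.Prop7SectET3HilbertLetters (W₂ toL2 toL2S DL2 DstarL2 covLapSite adjoint_DL2 inner_toL2)
open Summit.QuantumFields.YangMills.Theorems.Prop7SectET3RealCoordSums (inner_toL2S)
open Summit.QuantumFields.YangMills.Theorems.Prop7LaplaceAFlatLetters (norm_sq_toL2 norm_sq_toL2S)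
open Summit.QuantumFields.YangMills.Theorems.Prop7Lane2CutoffCommutators (DL2_smul_sub_smul_eq_toL2 norm_sq_DL2_smul_sub_le sum_pbond_tgt coe_bgUnits_mem_unitary')
open Summit.QuantumFields.YangMills.Theorems.Prop7LandauDict (DL2_toL2S_eq_covDerivFwdT)
open Summit.QuantumFields.YangMills.Theorems.Prop7CovariantCoercivity (norm_conjR_sub_conjR_le sum_norm_sq_le_mul_opNorm_sq sum_norm_sq_R)
open Summit.QuantumFields.YangMills.Theorems.Prop7SymAvgTwSym (unitsField_toUField_mem_U1')
open Summit.QuantumFields.YangMills.Theorems.Prop7MassivePropagatorAgmonLetters (inner_toL2S_smul_left inner_toL2_smul_left norm_toL2S_smul_le)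

variable (F : T3Family) {n K : ℕ} {c₀ : ℝ} [Fact (0 < c₀)]
  (U V : GaugeField (F.P K) 0 (Matrix.specialUnitaryGroup (Fin 2) ℂ))

/-! ## §0 Letters -/

/-- **THE DIFFERENCE OF TWO COVARIANT GRADIENTS IS A BOND MULTIPLIER**: `((D_U − D_V)λ)(b) = η⁻¹·(Ad(U_b) − Ad(V_b))λ(b₊)` (the `−λ(b₋)` parts cancel).
[cite: Balaban1985BackgroundPropagators, (3.3) p.391] -/
theorem DL2_sub_DL2_symm_apply (l : Site (F.P K) 0 → Matrix (Fin 2) (Fin 2) ℂ) (b : PBond (F.P K) 0) :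
    (toL2 F K c₀).symm (DL2 F n K c₀ U (toL2S F K c₀ l) - DL2 F n K c₀ V (toL2S F K c₀ l)) b
      = (eta F n K)⁻¹ • (conjR (bgUnits F K U b) (l b.tgt) - conjR (bgUnits F K V b) (l b.tgt)) := by
  rw [map_sub, Pi.sub_apply, DL2_toL2S_eq_covDerivFwdT, DL2_toL2S_eq_covDerivFwdT]
  simp only [covDerivFwdT, PBond.tgt]
  rw [← smul_sub, sub_sub_sub_cancel_right]

/-- the Frobenius size of the gradient difference at ONE bond: `Σ_jk|((D_U − D_V)λ)(b)_{jk}|² ≤ 8δ²·Σ_jk|λ(b₊)_{jk}|²` when `‖U_b − V_b‖ ≤ δη`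
(`‖Ad u′X − Ad uX‖ ≤ 2‖u′ − u‖‖X‖`, Frobenius `≤ 2·`op² on `M₂`, op² `≤` Frobenius). [cite: Balaban1985BackgroundPropagators, (3.3) p.391; Balaban1985Averaging, (56) p.27] -/
theorem sum_normSq_DL2_sub_DL2_apply_le (l : Site (F.P K) 0 → Matrix (Fin 2) (Fin 2) ℂ) (b : PBond (F.P K) 0) {δ : ℝ}
    (hUV : ‖((bgUnits F K U b : (Matrix (Fin 2) (Fin 2) ℂ)ˣ) : Matrix (Fin 2) (Fin 2) ℂ) - ((bgUnits F K V b : (Matrix (Fin 2) (Fin 2) ℂ)ˣ) : Matrix (Fin 2) (Fin 2) ℂ)‖ ≤ δ * eta F n K) :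
    ∑ j : Fin 2, ∑ k : Fin 2, ‖((toL2 F K c₀).symm (DL2 F n K c₀ U (toL2S F K c₀ l) - DL2 F n K c₀ V (toL2S F K c₀ l)) b) j k‖ ^ 2
      ≤ 8 * δ ^ 2 * ∑ j : Fin 2, ∑ k : Fin 2, ‖l b.tgt j k‖ ^ 2 := by
  have hη : 0 < eta F n K := eta_pos F n K
  rw [DL2_sub_DL2_symm_apply]
  set Y : Matrix (Fin 2) (Fin 2) ℂ := conjR (bgUnits F K U b) (l b.tgt) - conjR (bgUnits F K V b) (l b.tgt) with hY
  have hU1 : bgUnits F K U b ∈ U1 (Matrix (Fin 2) (Fin 2) ℂ) := unitsField_toUField_mem_U1' U b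
  have hV1 : bgUnits F K V b ∈ U1 (Matrix (Fin 2) (Fin 2) ℂ) := unitsField_toUField_mem_U1' V b
  have hYop : ‖Y‖ ≤ 2 * (δ * eta F n K) * ‖l b.tgt‖ := by
    rw [hY]
    refine (norm_conjR_sub_conjR_le hV1 hU1 (l b.tgt)).trans ?_
    exact mul_le_mul_of_nonneg_right (mul_le_mul_of_nonneg_left hUV (by norm_num)) (norm_nonneg _)
  have hfrob : ∑ j : Fin 2, ∑ k : Fin 2, ‖((eta F n K)⁻¹ • Y) j k‖ ^ 2 ≤ 2 * ‖(eta F n K)⁻¹ • Y‖ ^ 2 := by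
    have := sum_norm_sq_le_mul_opNorm_sq (N := 2) ((eta F n K)⁻¹ • Y)
    simpa using this
  have hsm : ‖(eta F n K)⁻¹ • Y‖ ≤ 2 * δ * ‖l b.tgt‖ := by
    rw [norm_smul, norm_inv, Real.norm_of_nonneg hη.le]
    calc (eta F n K)⁻¹ * ‖Y‖ ≤ (eta F n K)⁻¹ * (2 * (δ * eta F n K) * ‖l b.tgt‖) := mul_le_mul_of_nonneg_left hYop (inv_nonneg.mpr hη.le)
      _ = 2 * δ * ‖l b.tgt‖ := by field_simp
  have hop : ‖l b.tgt‖ ^ 2 ≤ ∑ j : Fin 2, ∑ k : Fin 2, ‖l b.tgt j k‖ ^ 2 := MatrixNorms.opNorm_sq_le_sum_norm_sq (l b.tgt)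
  have h1 : ‖(eta F n K)⁻¹ • Y‖ ^ 2 ≤ (2 * δ * ‖l b.tgt‖) ^ 2 := pow_le_pow_left₀ (norm_nonneg _) hsm 2
  nlinarith [hfrob, h1, hop, sq_nonneg δ]

/-- **A PAIRING WITH A BOND FIELD SUPPORTED IN `S` SEES ONLY `S`**: `‖⟪toL2 A, toL2 B⟫‖ ≤ √(c₀Σ_{b∈S}Σ_jk|A(b)_jk|²)·‖toL2 B‖` when `B = 0` off `S`.
[cite: Balaban1985BackgroundPropagators, (3.11) p.392] -/
theorem norm_inner_toL2_le_of_support (A B : PBond (F.P K) 0 → Matrix (Fin 2) (Fin 2) ℂ) (S : Finset (PBond (F.P K) 0)) (hB : ∀ b, b ∉ S → B b = 0) :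
    ‖⟪toL2 F K c₀ A, toL2 F K c₀ B⟫_ℂ‖ ≤ Real.sqrt (c₀ * ∑ b ∈ S, ∑ j : Fin 2, ∑ k : Fin 2, ‖A b j k‖ ^ 2) * ‖toL2 F K c₀ B‖ := by
  classical
  have hc : 0 < c₀ := Fact.out
  set A' : PBond (F.P K) 0 → Matrix (Fin 2) (Fin 2) ℂ := fun b => if b ∈ S then A b else 0 with hA'
  have heq : ⟪toL2 F K c₀ A, toL2 F K c₀ B⟫_ℂ = ⟪toL2 F K c₀ A', toL2 F K c₀ B⟫_ℂ := by
    rw [inner_toL2, inner_toL2]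
    congr 1
    refine Finset.sum_congr rfl fun b _ => ?_
    by_cases hb : b ∈ S
    · rw [hA']; simp only [if_pos hb]
    · rw [hB b hb, Matrix.mul_zero, Matrix.mul_zero]
  have hnA' : ‖toL2 F K c₀ A'‖ ^ 2 = c₀ * ∑ b ∈ S, ∑ j : Fin 2, ∑ k : Fin 2, ‖A b j k‖ ^ 2 := by
    rw [norm_sq_toL2, ← Finset.sum_filter_add_sum_filter_not Finset.univ (fun b => b ∈ S)]
    have h1 : ∑ b ∈ Finset.univ.filter (fun b => b ∈ S), ∑ i : Fin 2, ∑ i' : Fin 2, ‖A' b i i'‖ ^ 2 = ∑ b ∈ S, ∑ j : Fin 2, ∑ k : Fin 2, ‖A b j k‖ ^ 2 := by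
      rw [Finset.filter_mem_eq_inter, Finset.univ_inter]
      refine Finset.sum_congr rfl fun b hb => ?_
      simp only [hA', if_pos hb]
    have h2 : ∑ b ∈ Finset.univ.filter (fun b => ¬ b ∈ S), ∑ i : Fin 2, ∑ i' : Fin 2, ‖A' b i i'‖ ^ 2 = 0 := by
      refine Finset.sum_eq_zero fun b hb => ?_
      have hb' : b ∉ S := (Finset.mem_filter.mp hb).2
      simp only [hA', if_neg hb', Matrix.zero_apply, norm_zero]
      simp
    rw [h1, h2, add_zero]
  rw [heq]
  calc ‖⟪toL2 F K c₀ A', toL2 F K c₀ B⟫_ℂ‖ ≤ ‖toL2 F K c₀ A'‖ * ‖toL2 F K c₀ B‖ := norm_inner_le_norm _ _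
    _ = Real.sqrt (c₀ * ∑ b ∈ S, ∑ j : Fin 2, ∑ k : Fin 2, ‖A b j k‖ ^ 2) * ‖toL2 F K c₀ B‖ := by
        rw [← hnA', Real.sqrt_sq (norm_nonneg _)]

/-- **THE GRADIENT DIFFERENCE ON A BOND SET WHERE THE BACKGROUNDS ARE CLOSE**: `‖U_b − V_b‖ ≤ δη` for `b ∈ S` ⟹ `c₀Σ_{b∈S}hs(((D_U − D_V)λ)(b)) ≤ 24δ²·‖toL2S λ‖²`
(every site is the target of 3 bonds). [cite: Balaban1985BackgroundPropagators, (3.3) p.391, (3.11) p.392] -/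
theorem normSq_on_DL2_sub_DL2_le (l : Site (F.P K) 0 → Matrix (Fin 2) (Fin 2) ℂ) (S : Finset (PBond (F.P K) 0)) {δ : ℝ}
    (hUV : ∀ b ∈ S, ‖((bgUnits F K U b : (Matrix (Fin 2) (Fin 2) ℂ)ˣ) : Matrix (Fin 2) (Fin 2) ℂ) - ((bgUnits F K V b : (Matrix (Fin 2) (Fin 2) ℂ)ˣ) : Matrix (Fin 2) (Fin 2) ℂ)‖ ≤ δ * eta F n K) :
    c₀ * ∑ b ∈ S, ∑ j : Fin 2, ∑ k : Fin 2, ‖((toL2 F K c₀).symm (DL2 F n K c₀ U (toL2S F K c₀ l) - DL2 F n K c₀ V (toL2S F K c₀ l)) b) j k‖ ^ 2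
      ≤ 24 * δ ^ 2 * ‖toL2S F K c₀ l‖ ^ 2 := by
  have hc : 0 < c₀ := Fact.out
  have hS : ∑ b ∈ S, ∑ j : Fin 2, ∑ k : Fin 2, ‖((toL2 F K c₀).symm (DL2 F n K c₀ U (toL2S F K c₀ l) - DL2 F n K c₀ V (toL2S F K c₀ l)) b) j k‖ ^ 2
      ≤ ∑ b : PBond (F.P K) 0, 8 * δ ^ 2 * ∑ j : Fin 2, ∑ k : Fin 2, ‖l b.tgt j k‖ ^ 2 := by
    refine le_trans (Finset.sum_le_sum fun b hb => sum_normSq_DL2_sub_DL2_apply_le F U V l b (hUV b hb)) ?_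
    exact Finset.sum_le_sum_of_subset_of_nonneg (Finset.subset_univ S) fun b _ _ => by positivity
  rw [← Finset.mul_sum, sum_pbond_tgt F K (fun _ x => ∑ j : Fin 2, ∑ k : Fin 2, ‖l x j k‖ ^ 2), Finset.sum_const, Finset.card_univ, Fintype.card_fin, nsmul_eq_mul,
    Nat.cast_ofNat] at hS
  rw [norm_sq_toL2S]
  calc c₀ * ∑ b ∈ S, ∑ j : Fin 2, ∑ k : Fin 2, ‖((toL2 F K c₀).symm (DL2 F n K c₀ U (toL2S F K c₀ l) - DL2 F n K c₀ V (toL2S F K c₀ l)) b) j k‖ ^ 2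
      ≤ c₀ * (8 * δ ^ 2 * (3 * ∑ x : Site (F.P K) 0, ∑ j : Fin 2, ∑ k : Fin 2, ‖l x j k‖ ^ 2)) := mul_le_mul_of_nonneg_left hS hc.le
    _ = 24 * δ ^ 2 * (c₀ * ∑ x : Site (F.P K) 0, ∑ j : Fin 2, ∑ k : Fin 2, ‖l x j k‖ ^ 2) := by ring

omit [Fact (0 < c₀)] in
/-- **A BOUNDED BOND MULTIPLIER IS BOUNDED**: `|w| ≤ ρ` ⟹ `‖toL2(w·A)‖ ≤ ρ‖toL2 A‖`. [cite: Balaban1985BackgroundPropagators, (3.11) p.392] -/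
theorem norm_toL2_smul_le [Fact (0 < c₀)] (w : PBond (F.P K) 0 → ℝ) {ρ : ℝ} (hρ : 0 ≤ ρ) (hw : ∀ b, |w b| ≤ ρ) (A : PBond (F.P K) 0 → Matrix (Fin 2) (Fin 2) ℂ) :
    ‖toL2 F K c₀ (fun b => w b • A b)‖ ≤ ρ * ‖toL2 F K c₀ A‖ := by
  have hc : 0 < c₀ := Fact.out
  have hpt : ∀ (b : PBond (F.P K) 0) (j k : Fin 2), ‖(w b • A b) j k‖ ^ 2 ≤ ρ ^ 2 * ‖A b j k‖ ^ 2 := by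
    intro b j k
    rw [Matrix.smul_apply, norm_smul, mul_pow, Real.norm_eq_abs]
    exact mul_le_mul_of_nonneg_right (pow_le_pow_left₀ (abs_nonneg _) (hw b) 2) (sq_nonneg _)
  have h2 : ‖toL2 F K c₀ (fun b => w b • A b)‖ ^ 2 ≤ (ρ * ‖toL2 F K c₀ A‖) ^ 2 := by
    rw [mul_pow, norm_sq_toL2, norm_sq_toL2]
    have hsum : ∑ b : PBond (F.P K) 0, ∑ j : Fin 2, ∑ k : Fin 2, ‖(w b • A b) j k‖ ^ 2 ≤ ∑ b : PBond (F.P K) 0, ∑ j : Fin 2, ∑ k : Fin 2, ρ ^ 2 * ‖A b j k‖ ^ 2 :=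
      Finset.sum_le_sum fun b _ => Finset.sum_le_sum fun j _ => Finset.sum_le_sum fun k _ => hpt b j k
    have e : ∑ b : PBond (F.P K) 0, ∑ j : Fin 2, ∑ k : Fin 2, ρ ^ 2 * ‖A b j k‖ ^ 2 = ρ ^ 2 * ∑ b : PBond (F.P K) 0, ∑ j : Fin 2, ∑ k : Fin 2, ‖A b j k‖ ^ 2 := by
      simp_rw [Finset.mul_sum]
    rw [e] at hsum
    calc c₀ * ∑ b : PBond (F.P K) 0, ∑ j : Fin 2, ∑ k : Fin 2, ‖(w b • A b) j k‖ ^ 2 ≤ c₀ * (ρ ^ 2 * ∑ b : PBond (F.P K) 0, ∑ j : Fin 2, ∑ k : Fin 2, ‖A b j k‖ ^ 2) :=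
          mul_le_mul_of_nonneg_left hsum hc.le
      _ = ρ ^ 2 * (c₀ * ∑ b : PBond (F.P K) 0, ∑ j : Fin 2, ∑ k : Fin 2, ‖A b j k‖ ^ 2) := by ring
  exact (pow_le_pow_iff_left₀ (norm_nonneg _) (by positivity) two_ne_zero).1 h2

/-- **THE LEIBNIZ DEFECT IS `√3η⁻¹θ`-BOUNDED**: `|χ(b₊) − χ(b₋)| ≤ θ` on every bond ⟹ `‖D_V(χ·y) − toL2(χ(b₋)·D_Vy)‖ ≤ √3·η⁻¹θ·‖toL2S y‖`
(✓`norm_sq_DL2_smul_sub_le` at `S = univ`). [cite: Balaban1985BackgroundPropagators, (3.3) p.391, (3.100) pp.413–414] -/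
theorem norm_leibnizDefect_le (χ : Site (F.P K) 0 → ℝ) {θ : ℝ} (hθ : 0 ≤ θ) (hχ : ∀ (x : Site (F.P K) 0) (μ : Fin 3), |χ (x.shift μ) - χ x| ≤ θ)
    (y : Site (F.P K) 0 → Matrix (Fin 2) (Fin 2) ℂ) :
    ‖DL2 F n K c₀ V (toL2S F K c₀ (fun x => χ x • y x)) - toL2 F K c₀ (fun b => χ b.src • (toL2 F K c₀).symm (DL2 F n K c₀ V (toL2S F K c₀ y)) b)‖
      ≤ Real.sqrt 3 * (eta F n K)⁻¹ * θ * ‖toL2S F K c₀ y‖ := by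
  have hη : 0 < eta F n K := eta_pos F n K
  have h := norm_sq_DL2_smul_sub_le F n K c₀ V χ y (Finset.univ : Finset (Site (F.P K) 0)) hχ (fun x μ _ => Finset.mem_univ _)
  rw [← norm_sq_toL2S] at h
  have h2 : ‖DL2 F n K c₀ V (toL2S F K c₀ (fun x => χ x • y x)) - toL2 F K c₀ (fun b => χ b.src • (toL2 F K c₀).symm (DL2 F n K c₀ V (toL2S F K c₀ y)) b)‖ ^ 2
      ≤ (Real.sqrt 3 * (eta F n K)⁻¹ * θ * ‖toL2S F K c₀ y‖) ^ 2 := by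
    rw [mul_pow, mul_pow, mul_pow, Real.sq_sqrt (by norm_num : (0:ℝ) ≤ 3)]
    calc _ ≤ 3 * θ ^ 2 * ((eta F n K)⁻¹) ^ 2 * ‖toL2S F K c₀ y‖ ^ 2 := h
      _ = 3 * ((eta F n K)⁻¹) ^ 2 * θ ^ 2 * ‖toL2S F K c₀ y‖ ^ 2 := by ring
  exact (pow_le_pow_iff_left₀ (norm_nonneg _) (by positivity) two_ne_zero).1 h2

end Summit.QuantumFields.YangMills.Theorems.Prop7CutoffLaplacianLetters

end
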